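import Mathlib
import Summits.Ventures.PercRepro2.SwOutCrossJunctionExample
import Summits.Ventures.PercRepro2.SwOutSevDefs

/-!
# The instance `crossEx` is outside Theorem A_sev (blind cell PercRepro2, night-4 g24,
2026-08-28; proofs/NIGHT4-G24.md §8)

On `crossEx` the several-arms junction of Theorem A_sev (`MixedJunctionR`, g22) FAILS for the
dropped vertices `p₁ = 4`, `p₂ = 5`: hypothesis (b) asks every neighbour of `p₁` inside `U` other
than `u` to be adjacent to `h`, but `p₂` is such a neighbour (the cross edge `p₁p₂`) and no edge
joins `p₂` to `h` (`crossEx_not_mixedJunctionR`); the single junction of Theorem A_mix is the case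
of one dropped vertex.  So row (SW) on `crossEx` (`sw_crossEx`) is new to the tree: the cross
junction is the first junction theorem covering it.
-/

namespace Summit.Ventures.PercRepro2

namespace CrossArm

open Hull LocRows

open scoped Classical

/-- **Theorem A_sev's junction fails on `crossEx`** (for the dropped vertices `p₁ p₂`): `p₂` is
a neighbour of `p₁` inside `U` not adjacent to `h`. -/
theorem crossEx_not_mixedJunctionR : ¬ MixedArms.MixedJunctionR crossEx ({0}ᶜ) 1 3 crossExP 2 := by
  intro hj
  obtain ⟨e', he'⟩ := hj.hp_adj_h 0 4 5 rfl (by simp) (by decide)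
  revert he'
  fin_cases e' <;> decide

end CrossArm

end Summit.Ventures.PercRepro2
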